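import Mathlib
import HarnessLib
import Literature.Analysis.FluidPDE.TypeIAncientMildClassical
import Literature.Analysis.FluidPDE.KNSSSmoothingHolds
import Literature.Analysis.FluidPDE.KNSSThm52Integrand

/-!
# Crux `SymmetryModuliCount.FarPastLedger` (stmt-NavierStokesRegularity-14060), line
# `uloc-gronwall-transplant`: stub `stub_fplPressureGradientBound` (GRADP)

Helper file (lands `--supports stmt-NavierStokesRegularity-14060`; theorems only, no definitions,
no named facts) proving the registered stub `stub_fplPressureGradientBound` of the line's
skeleton: for a Type I ancient mild field `u ∈ A_C` (`IsTypeIAncientMild C u`: jointly smooth on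
`t < 0`, divergence free, KNSS/Oseen mild between all pairs of negative times,
`‖u(t, x)‖ ≤ C/√(−t)`) and a classical pressure `p` of `u` on a window `(t₀, 0)`
(`IsClassicalNSSolutionOn (Ioo t₀ 0) 1 0 u p`), the pressure gradient `∇p(τ, ·)` is bounded on
`ℝ³` at every window time `τ ∈ (t₀, 0)`.

Proof. The momentum equation gives `∇p(τ) = Δu(τ) − (u·∇)u(τ) − ∂ₜu(τ)` pointwise (the window
is open, so the one-sided time derivative is the two-sided one). The three terms are bounded
uniformly in `x` by KNSS smoothing (Koch–Nadirashvili–Seregin–Šverák 2009, Prop. 4.1, the PROVED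
tree fact `knss2009_smoothing_holds`) applied on the slab `(s, T₁) = (τ − 1, τ/2)` to the Oseen
identity `u(t) = e^{(t−s)Δ}u(s) − B_s(u,u)(t)` from the earlier time `s = τ − 1`, whose canonical
representative IS `u` pointwise (`IsTypeIAncientMild.mild_eq_heatExtension`): all weighted
derivatives `(t − s)^{k/2+l} ‖∇ᵏ∂ₜˡu‖` are bounded there, and `τ − s = 1`.

## References

* G. Koch, N. Nadirashvili, G. Seregin, V. Šverák, *Liouville theorems for the Navier–Stokes
  equations and applications*, Acta Math. 203 (2009) 83–105 = arXiv:0709.3599, Prop. 4.1.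
  [KochNadirashviliSereginSverak2009]
-/

noncomputable section

open MeasureTheory Set Filter Topology Function
open scoped Laplacian ContDiff ENNReal
open Literature.Analysis.FluidPDE Literature.Analysis.UnboundedOperators

set_option linter.dupNamespace false -- nested layout Summit.<S>.<Sub>, Sub = S (D-0017)

namespace Summit.NavierStokesRegularity.NavierStokesRegularity.Theorems

/-- **KNSS smoothing for a Type I ancient mild field, weighted form.** For `u ∈ A_C` and times
`s < τ < T₁ < 0`: `(τ − s)‖D²u(τ, x)‖`, `(τ − s)^{1/2}‖Du(τ, x)‖` and `(τ − s)‖∂ₜu(τ, x)‖` are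
bounded uniformly in `x` (KNSS 2009, Prop. 4.1 = `knss2009_smoothing_holds`, applied on
`(s, T₁)` to the datum `u(s)` bounded by `C/√(−T₁)`; the canonical representative
`e^{(t−s)Δ}u(s) − B_s(u,u)(t)` equals `u` pointwise there by
`IsTypeIAncientMild.mild_eq_heatExtension`, so its derivatives are those of `u`).
[cite: KochNadirashviliSereginSverak2009, Prop. 4.1 (arXiv:0709.3599 p. 8)] -/
theorem fpl_gradp_exists_weighted_deriv_bounds {C : ℝ}
    {u : ℝ → EuclideanSpace ℝ (Fin 3) → EuclideanSpace ℝ (Fin 3)} (hu : IsTypeIAncientMild C u)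
    {s τ T₁ : ℝ} (hsτ : s < τ) (hτT : τ < T₁) (hT₁ : T₁ < 0) :
    ∃ K₂ K₁ K₀ : ℝ, ∀ x : EuclideanSpace ℝ (Fin 3),
      (τ - s) * ‖iteratedFDeriv ℝ 2 (u τ) x‖ ≤ K₂ ∧
      (τ - s) ^ ((1 : ℝ) / 2) * ‖fderiv ℝ (u τ) x‖ ≤ K₁ ∧
      (τ - s) * ‖deriv (fun t => u t x) τ‖ ≤ K₀ := by
  have hsT : s < T₁ := hsτ.trans hτT
  set M : ℝ := C / Real.sqrt (-T₁) with hM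
  have hM0 : 0 ≤ M := div_nonneg hu.nonneg (Real.sqrt_nonneg _)
  have hbound : ∀ t ∈ Ioo (s - 1) T₁, ∀ y, ‖u t y‖ ≤ M := fun t ht y =>
    hu.norm_le_of_mem_Ioo hT₁ ht y
  have hs0 : s < 0 := hsT.trans hT₁
  have ha_meas : AEStronglyMeasurable (u s) volume := hu.aestronglyMeasurable_slice hs0
  have ha_bd : eLpNorm (u s) ∞ volume ≤ ENNReal.ofReal M := by
    rw [eLpNorm_exponent_top]
    exact eLpNormEssSup_le_of_ae_bound
      (Eventually.of_forall fun y => hbound s ⟨by linarith, hsT⟩ y)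
  have hu_meas : AEStronglyMeasurable (uncurry u) (volume.restrict (Ioo s T₁ ×ˢ univ)) :=
    hu.aestronglyMeasurable_uncurry hT₁.le
  have hu_bd : ∀ t ∈ Ioo s T₁, eLpNorm (u t) ∞ volume ≤ ENNReal.ofReal M := by
    intro t ht
    rw [eLpNorm_exponent_top]
    exact eLpNormEssSup_le_of_ae_bound
      (Eventually.of_forall fun y => hbound t ⟨by linarith [ht.1], ht.2⟩ y)
  -- the canonical representative of the Oseen identity from time `s` is `u` itself, pointwise
  have hw_eq : ∀ t ∈ Ioo s T₁, ∀ y,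
      heatExtension (u s) (1 * (t - s)) y - oseenDuhamel 1 s u u t y = u t y := by
    intro t ht y
    rw [one_mul]
    exact (hu.mild_eq_heatExtension ht.1 (ht.2.trans hT₁) y).symm
  have hmild : ∀ t ∈ Ioo s T₁, u t =ᵐ[volume] fun x =>
      heatExtension (u s) (1 * (t - s)) x - oseenDuhamel 1 s u u t x := fun t ht =>
    Eventually.of_forall fun y => (hw_eq t ht y).symm
  obtain ⟨-, -, hbd⟩ :=
    knss2009_smoothing_holds (EuclideanSpace ℝ (Fin 3)) one_pos hsT hM0 ha_meas ha_bd hu_meas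
      hu_bd hmild
  obtain ⟨C₂, hC₂⟩ := hbd 2 0
  obtain ⟨C₁, hC₁⟩ := hbd 1 0
  obtain ⟨C₀, hC₀⟩ := hbd 0 1
  have hτmem : τ ∈ Ioo s T₁ := ⟨hsτ, hτT⟩
  -- undifferentiated-in-time slice of the representative at `τ` is `u τ`
  have hfun : (fun y => iteratedDeriv 0
      (fun τ' => heatExtension (u s) (1 * (τ' - s)) y - oseenDuhamel 1 s u u τ' y) τ) = u τ := by
    funext y
    rw [iteratedDeriv_zero]
    exact hw_eq τ hτmem y
  refine ⟨C₂, C₁, C₀, fun x => ⟨?_, ?_, ?_⟩⟩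
  · have h := hC₂ τ hτmem x
    rw [hfun] at h
    have hexp : (τ - s) ^ (((2 : ℕ) : ℝ) / 2 + ((0 : ℕ) : ℝ)) = τ - s := by norm_num
    rwa [hexp] at h
  · have h := hC₁ τ hτmem x
    rw [hfun, ← norm_iteratedFDeriv_fderiv, norm_iteratedFDeriv_zero] at h
    have hexp : (τ - s) ^ (((1 : ℕ) : ℝ) / 2 + ((0 : ℕ) : ℝ)) = (τ - s) ^ ((1 : ℝ) / 2) := by
      norm_num
    rwa [hexp] at h
  · have h := hC₀ τ hτmem x
    rw [norm_iteratedFDeriv_zero, iteratedDeriv_one] at h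
    have hev : (fun τ' => heatExtension (u s) (1 * (τ' - s)) x - oseenDuhamel 1 s u u τ' x)
        =ᶠ[𝓝 τ] fun τ' => u τ' x :=
      mem_of_superset (isOpen_Ioo.mem_nhds hτmem) fun t ht => hw_eq t ht x
    rw [hev.deriv_eq] at h
    have hexp : (τ - s) ^ (((0 : ℕ) : ℝ) / 2 + ((1 : ℕ) : ℝ)) = τ - s := by norm_num
    rwa [hexp] at h

/-- **Stub GRADP `stub_fplPressureGradientBound`** (crux stmt-NavierStokesRegularity-14060, line
`uloc-gronwall-transplant`): on a window `(t₀, 0)` the pressure gradient of the classical pair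
`(u, p)` of a Type I ancient mild field is bounded in space at each time `τ ∈ (t₀, 0)`:
`∇p = Δu − (u·∇)u − ∂ₜu` (momentum equation, `IsClassicalNSSolutionOn.momentum`, with the
two-sided time derivative on the open window) and `‖Δu(τ)‖ ≤ 3‖D²u(τ)‖`
(`norm_laplacian_le_three_mul`),
`‖(u·∇)u(τ)‖ ≤ ‖Du(τ)‖ ‖u(τ)‖ ≤ ‖Du(τ)‖ · C/√(−τ)`, `‖∂ₜu(τ)‖` are bounded uniformly in `x` by
KNSS smoothing from the earlier time `τ − 1` (`fpl_gradp_exists_weighted_deriv_bounds`, weight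
`τ − s = 1`). [cite: KochNadirashviliSereginSverak2009, Prop. 4.1 (arXiv:0709.3599 p. 8)] -/
theorem stub_fplPressureGradientBound :
    ∀ (C : ℝ) (u : ℝ → EuclideanSpace ℝ (Fin 3) → EuclideanSpace ℝ (Fin 3)),
    Literature.Analysis.FluidPDE.IsTypeIAncientMild C u →
    ∀ (t₀ : ℝ) (p : ℝ → EuclideanSpace ℝ (Fin 3) → ℝ),
    Literature.Analysis.FluidPDE.IsClassicalNSSolutionOn (Set.Ioo t₀ 0) 1 0 u p →
    ∀ τ ∈ Set.Ioo t₀ 0, ∃ L : ℝ, ∀ x : EuclideanSpace ℝ (Fin 3), ‖fderiv ℝ (p τ) x‖ ≤ L := by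
  intro C u hu t₀ p hcl τ hτ
  have hτ0 : τ < 0 := hτ.2
  obtain ⟨K₂, K₁, K₀, hK⟩ := fpl_gradp_exists_weighted_deriv_bounds hu (s := τ - 1) (τ := τ)
    (T₁ := τ / 2) (by linarith) (by linarith) (by linarith)
  refine ⟨3 * K₂ + K₁ * (C / Real.sqrt (-τ)) + K₀, fun x => ?_⟩
  obtain ⟨h2, h1, h0⟩ := hK x
  have hτs : τ - (τ - 1) = 1 := by ring
  rw [hτs, one_mul] at h2 h0
  rw [hτs, Real.one_rpow, one_mul] at h1
  -- the momentum equation at `(τ, x)`, two-sided time derivative on the open window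
  have hmom := hcl.momentum τ hτ x
  rw [timeDerivWithin_eq_deriv isOpen_Ioo hτ u x, one_smul] at hmom
  have hgrad : gradient (p τ) x =
      (Δ (u τ)) x - convect (u τ) (u τ) x - deriv (fun t => u t x) τ := by
    have h' : gradient (p τ) x =
        (Δ (u τ)) x + (0 : ℝ → EuclideanSpace ℝ (Fin 3) → EuclideanSpace ℝ (Fin 3)) τ x -
          (deriv (fun t => u t x) τ + convect (u τ) (u τ) x) := by
      rw [hmom]; abel
    rw [h', Pi.zero_apply, Pi.zero_apply, add_zero]
    abel
  have hnorm : ‖fderiv ℝ (p τ) x‖ = ‖gradient (p τ) x‖ := by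
    rw [gradient, LinearIsometryEquiv.norm_map]
  rw [hnorm, hgrad]
  have hΔ : ‖(Δ (u τ)) x‖ ≤ 3 * K₂ :=
    (norm_laplacian_le_three_mul (u τ) x).trans (mul_le_mul_of_nonneg_left h2 (by norm_num))
  have hux : ‖u τ x‖ ≤ C / Real.sqrt (-τ) := hu.norm_le hτ0 x
  have hop : ‖convect (u τ) (u τ) x‖ ≤ ‖fderiv ℝ (u τ) x‖ * ‖u τ x‖ := by
    rw [convect_apply]
    exact (fderiv ℝ (u τ) x).le_opNorm (u τ x)
  have hconv : ‖convect (u τ) (u τ) x‖ ≤ K₁ * (C / Real.sqrt (-τ)) :=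
    hop.trans (mul_le_mul h1 hux (norm_nonneg _) ((norm_nonneg _).trans h1))
  have htri : ‖(Δ (u τ)) x - convect (u τ) (u τ) x - deriv (fun t => u t x) τ‖
      ≤ ‖(Δ (u τ)) x‖ + ‖convect (u τ) (u τ) x‖ + ‖deriv (fun t => u t x) τ‖ :=
    (norm_sub_le _ _).trans (add_le_add (norm_sub_le _ _) le_rfl)
  exact htri.trans (add_le_add (add_le_add hΔ hconv) h0)

end Summit.NavierStokesRegularity.NavierStokesRegularity.Theorems

end
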